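import Summits.BirchSwinnertonDyer.BirchSwinnertonDyer.Theses.KatoDescentTamePotSupersingular
import HarnessLib

/-!
# BC3 BIRTH SKELETON v1 (ARCHIVED as an alternative line by plan g22; the registered skeleton is Lines/birth.lean v2) — crux `TameCoatesSujathaResidue` (item stmt-BirchSwinnertonDyer-19916; route KT =
# `Theses/KatoDescentTamePotSupersingular.lean` rev 22, rank 7; planner bsd-potss-plan g21, 2026-08-27)

The crux is Coates–Sujatha's Conjecture A (the fine Selmer dual `Y(W/ℚ_cyc)` is finitely generated
over `ℤ_p`, in the tree's `FineSelmerDualData` reading consumed by the route's Kato-14.5(3) closer) on the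
TAME RESIDUE classes only: non-CM rank-0 curves, additive potentially good at an odd `p` of class T′
(`SubTprime`), `W[p]` irreducible, `p`-adic tower not onto, whose isogeny class has a lattice-optimal
member `W₀` that is EITHER Manin-dirty (`p ∣ c(D₀)`) OR has `p ∣ ∏ c_ℓ(W₀)` carried by no single
multiplicative prime `q ≠ p` — exactly the classes the sharp Heegner-index roads (`JetchevIrreducibleReadingByName`)
cannot reach.

THE CUT — by RESIDUE CLASS (the crux's own disjunction), because the two classes have different
literatures and different cheapest roads:
* `stub_residue_maninDirty` (S1, size L–XL): Conj A on the Manin-dirty residue class. Census: EMPTY on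
  the KT rows (k8t-c4 g6 tsv). Two roads: (a) EMPTINESS — `p ∤ c(D₀)` for the optimal member at an odd
  additive potentially-good `p` (Mazur 1978: `p ∣ c ⇒ p² ∣ 4N`, so not excluded a priori; Abbes–Ullmo 1996
  / Agashe–Ribet–Stein 2006 / Česnavičius 2018 give `p ∤ c` at semistable `p`; Edixhoven 1991 Thm. 3:
  `p ≥ 11 ∧ p ∣ c ⇒` Kodaira type II, III or IV and potentially ORDINARY at `p` — so the class is
  EMPTY at potentially supersingular `p ≥ 11`; Česnavičius–Neururer–Saha arXiv:1911.09446 main thm: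
  `ord_p c ≤ ord_p deg φ`; Cremona [Cre19]: `c = 1` for every optimal curve with `N ≤ 500000` — the
  road to check first, leaving `p ∈ {3,5,7}` and pot. ordinary `p ≥ 11` with `p ∣ deg φ`); (b) Conj A itself on the
  class (Coates–Sujatha 2005 Thm. 3.4 ⇐ classical `μ = 0` for `ℚ(W[p])_cyc`; Deo–Ray–Sujatha
  arXiv:2202.09937 criteria). WHY IT MIGHT FAIL: Conjecture A is open and a Manin-dirty optimal curve
  with additive potentially good `p ≥ 3` may exist outside the census range; one such curve with
  `μ(Y(W/ℚ_cyc)) ≠ 0` refutes it. SOURCES: CoatesSujatha2005 Thm 3.4; Mazur1978 (Manin constant);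
  arXiv:1911.09446; arXiv:2202.09937.
* `stub_residue_noSingleCarrier` (S2, size XL, conjecture-grade): Conj A on the multi-carrier residue
  class (`p ∣ ∏ c_ℓ(W₀)`, no single multiplicative `q ≠ p` with `ord_p ∏ c_ℓ ≤ ord_p c_q`). Census = the
  C/D multi-Tamagawa rows. Roads: (a) CONGRUENCE ANCHOR — `W[p] ≃ W′[p]` with Conj A known for `W′`
  transports Conj A (Lim–Sujatha 2018 Prop. 3.2, tree fact
  `LimSujatha2018.prop32_fineSelmerDual_moduleFinite_iff_of_torsionIso`; landed instance road p499727 /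
  p475647 `…FineSelmerRankOneCMAnchor`), but conjA-anchor g4 showed NO CM anchor exists on 6 rows, so the
  anchor must be non-CM with `μ = 0` known otherwise; (b) classical `μ(ℚ(W[p])_cyc) = 0` ⇒ Conj A
  (CS05 Thm. 3.4) — vocabulary not yet in the tree (definition request filed by plan g21). WHY IT MIGHT
  FAIL: Conj A open; a multi-carrier row with `μ ≠ 0` refutes it; road (a) has no anchor on ≥ 6 rows.
  SOURCES: CoatesSujatha2005; LimSujatha2018 Prop 3.2; Lim2017FineSelmer §3; arXiv:2202.09937.
`TameCoatesSujathaResidue_of` is the case split on the crux's disjunction. Two `sorry`s, both in stubs.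
Neither stub is the crux (each covers one residue class only) and neither implies `O5SharpTprime`.
-/

noncomputable section

open scoped Classical

open WeierstrassCurve Literature.NumberTheory.EllipticCurves
open Literature.NumberTheory.EllipticCurves.ModularForms
open Literature.NumberTheory.EllipticCurves.Rank1Residual

namespace Summit.BirchSwinnertonDyer.BirchSwinnertonDyer.Cruxes.TameCoatesSujathaResidue.BirthV1

/-- Statement of `stub_residue_maninDirty` (S1): Conjecture A (fine-Selmer-dual reading) on the tame
residue rows whose lattice-optimal isogenous member is Manin-dirty, `p ∣ c(D₀)`.
[CoatesSujatha2005 Thm 3.4; Mazur1978; arXiv:1911.09446; arXiv:2202.09937] -/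
abbrev Sig.stub_residue_maninDirty : Prop :=
  ∀ (W : WeierstrassCurve ℚ) [W.IsElliptic] [W.IsGloballyMinimal] (p : ℕ) [Fact p.Prime],
    W.analyticRank = 0 → p ≠ 2 → Addv W p →
    Summit.BirchSwinnertonDyer.Rank1Residual.Additive.SubTprime W p → ¬ W.HasCM →
    W.HasIrreducibleModPGaloisRep p → ¬ (∀ n : ℕ, W.HasSurjectiveModNGaloisRep (p ^ n : ℕ)) →
    (∃ (W₀ : WeierstrassCurve ℚ) (_ : W₀.IsElliptic) (_ : W₀.IsGloballyMinimal)
        (_ : NeZero (W₀.conductorNorm ℤ))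
        (D₀ : ModularParametrizationData W₀ (W₀.conductorNorm ℤ)),
      WeierstrassCurve.IsIsogenous W W₀ ∧
      (∀ z ∈ D₀.L.lattice, ∃ w ∈ periodLattice D₀.f, z = (D₀.c : ℂ) * w) ∧ (p : ℤ) ∣ D₀.c) →
    ∀ (κ : ZpExtension ℚ p), κ.IsCyclotomic →
      ∃ (γ : Field.absoluteGaloisGroup ℚ) (D : W.FineSelmerDualData κ γ),
        Module.Finite ℤ_[p] (RestrictScalars ℤ_[p] (IwasawaAlgebra p) D.X)

/-- Statement of `stub_residue_noSingleCarrier` (S2): Conjecture A (fine-Selmer-dual reading) on the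
tame residue rows whose lattice-optimal isogenous member has `p ∣ ∏ c_ℓ` carried by no single
multiplicative prime `q ≠ p`. [CoatesSujatha2005; LimSujatha2018 Prop 3.2; Lim2017FineSelmer §3;
arXiv:2202.09937] -/
abbrev Sig.stub_residue_noSingleCarrier : Prop :=
  ∀ (W : WeierstrassCurve ℚ) [W.IsElliptic] [W.IsGloballyMinimal] (p : ℕ) [Fact p.Prime],
    W.analyticRank = 0 → p ≠ 2 → Addv W p →
    Summit.BirchSwinnertonDyer.Rank1Residual.Additive.SubTprime W p → ¬ W.HasCM →
    W.HasIrreducibleModPGaloisRep p → ¬ (∀ n : ℕ, W.HasSurjectiveModNGaloisRep (p ^ n : ℕ)) →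
    (∃ (W₀ : WeierstrassCurve ℚ) (_ : W₀.IsElliptic) (_ : W₀.IsGloballyMinimal)
        (_ : NeZero (W₀.conductorNorm ℤ))
        (D₀ : ModularParametrizationData W₀ (W₀.conductorNorm ℤ)),
      WeierstrassCurve.IsIsogenous W W₀ ∧
      (∀ z ∈ D₀.L.lattice, ∃ w ∈ periodLattice D₀.f, z = (D₀.c : ℂ) * w) ∧
      (p ∣ W₀.tamagawaProduct ∧ ¬ ∃ (q : ℕ) (_ : Fact q.Prime),
        q ∣ W₀.conductorNorm ℤ ∧ ¬ q ^ 2 ∣ W₀.conductorNorm ℤ ∧ q ≠ p ∧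
        padicValNat p W₀.tamagawaProduct ≤
          padicValNat p ((W₀.baseChange ℚ_[q]).localTamagawaNumber ℤ_[q]))) →
    ∀ (κ : ZpExtension ℚ p), κ.IsCyclotomic →
      ∃ (γ : Field.absoluteGaloisGroup ℚ) (D : W.FineSelmerDualData κ γ),
        Module.Finite ℤ_[p] (RestrictScalars ℤ_[p] (IwasawaAlgebra p) D.X)

/-- S1 — registered stub. -/
theorem stub_residue_maninDirty : Sig.stub_residue_maninDirty := by
  sorry

/-- S2 — registered stub. -/
theorem stub_residue_noSingleCarrier : Sig.stub_residue_noSingleCarrier := by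
  sorry

/-- **The crux from the two stubs**: case split on the residue class of the optimal member,
concluding the KT route decl BY NAME. -/
theorem TameCoatesSujathaResidue_of (h₁ : Sig.stub_residue_maninDirty)
    (h₂ : Sig.stub_residue_noSingleCarrier) :
    Summit.BirchSwinnertonDyer.BirchSwinnertonDyer.Theses.KatoDescentTamePotSupersingular.TameCoatesSujathaResidue := by
  unfold Summit.BirchSwinnertonDyer.BirchSwinnertonDyer.Theses.KatoDescentTamePotSupersingular.TameCoatesSujathaResidue
  intro W _ _ p _ hr hp2 hadd hsub hcm hirr hns hopt κ hκ
  obtain ⟨W₀, hW₀e, hW₀m, hW₀n, D₀, hiso, hlat, hdisj⟩ := hopt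
  rcases hdisj with hc | ⟨htam, hno⟩
  · exact h₁ W p hr hp2 hadd hsub hcm hirr hns ⟨W₀, hW₀e, hW₀m, hW₀n, D₀, hiso, hlat, hc⟩ κ hκ
  · exact h₂ W p hr hp2 hadd hsub hcm hirr hns ⟨W₀, hW₀e, hW₀m, hW₀n, D₀, hiso, hlat, htam, hno⟩ κ hκ

end Summit.BirchSwinnertonDyer.BirchSwinnertonDyer.Cruxes.TameCoatesSujathaResidue.BirthV1

end
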